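import Literature.NumberTheory.EllipticCurves.ModularSymbolsProofs
import Mathlib.Analysis.SpecialFunctions.Complex.LogDeriv
import Mathlib.Analysis.SpecialFunctions.Complex.Arg
import HarnessLib

/-!
# Adapted coordinates of a hyperbolic element of `Γ₀(N)` and the band integral
# `∫_ℍ f · 𝟙_{[0,|ℓ|)}(log|w|) · 2∂B₀/∂z̄ dx dy = ± {∞, δ∞}_f / (2π)`

Theorems only (no definitions, no named facts). Third analytic brick of the proof of Riemann's
period relations for `X₀(N)` in Petersson form (hypothesis `hRB` of
`PastenSpectralDegreeHomologyProofs.lean`), after `Gamma0QuotientStokesProofs.lean` and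
`Gamma0UnfoldingProofs.lean`. Following Farkas–Kra II.3.3 the closed dual form `η_δ` of the
closed geodesic of a hyperbolic `δ ∈ Γ₀(N)` is built from a function `B₀ = b ∘ arg ∘ w` of the angle
in the coordinate `w(z) = (z - ξ₁)/(z - ξ₂)` adapted to `δ` (`ξ₂ < ξ₁` its fixed points,
`w(δz) = κ w(z)`), `b` a smooth step across the geodesic `arg w = π/2`; the pairing of a cusp form
`f ∈ S₂(Γ₀(N))` with `η_δ` unfolds (brick 2) to the integral over `ℍ` of `f · 2∂B₀/∂z̄` cut off to
one period `0 ≤ log|w| < |log κ|`, which is computed here. All objects are explicit (no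
definitions are introduced): `w`, `ζ = log w` (the strip coordinate, `δ` acting as the
translation by `ℓ = log κ`), the inverse `z(ζ) = (ξ₂e^ζ - ξ₁)/(e^ζ - 1)` on the strip
`0 < im ζ < π`, and `b(θ) = smoothTransition((θ - (π/2 - ε))/(2ε))`.

* `HypStrip.im_w_pos`, `hasDerivAt_log_w`, `arg_w_mem_Ioo`, `w_zInv`, `log_w_zInv`, `zInv_log_w`,
  `hasDerivAt_zInv`, `logDeriv_w_zInv_mul` — the coordinate and its inverse
  (`ζ' = 1/(z-ξ₁) - 1/(z-ξ₂)`, `z' = (ξ₁-ξ₂)e^ζ/(e^ζ-1)²`, `ζ'(z(ζ)) z'(ζ) = 1`);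
* `HypStrip.exists_coords_of_hyperbolic` — for `δ ∈ SL(2, ℤ)` with `(a+d)² > 4`: fixed points
  `ξ₂ < ξ₁`, multiplier `κ > 0`, `κ ≠ 1`, and `w(δz) = κ w(z)` on `ℍ` (Beardon §4.3 / Katok §2.1:
  hyperbolic elements are conjugate to homotheties); `log_w_moebius`, `arg_w_moebius`,
  `zInv_add_log` — `ζ(δz) = ζ(z) + ℓ`, `arg w(δz) = arg w(z)`, `z(ζ + ℓ) = δ z(ζ)`;
* `HypStrip.contDiff_band`, `band_eq_zero/one`, `deriv_band_eq_zero`, `integral_deriv_band` — the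
  step `b` (`= 0` below, `= 1` above the band `|θ - π/2| ≤ ε`, `∫₀^π b' = 1`);
* `HypStrip.inner_integral_eq` — `∫₀^{|ℓ|} f(z(ρ+iθ)) z'(ρ+iθ) dρ = sign(ℓ){∞, δ∞}_f/(2πi)` for
  every `θ ∈ (0,π)` (the Eichler integral `2πi∫_{i∞} f` is a primitive, `hasDerivAt_eichlerIntegral`,
  and `E(δτ) - E(τ) = {∞, δ∞}_f`, `eichlerIntegral_smul_sub_holds`);
* `HypStrip.setIntegral_uhp_eq_setIntegral_strip`, `strip_integrand_eq`,
  `setIntegral_strip_eq_iterated` — change of variables `z = z(ζ)` (Jacobian `|z'|²` as in the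
  tree's `det_restrictScalars_toSpanSingleton`, Mathlib
  `integral_image_eq_integral_abs_det_fderiv_smul`), the integrand on the strip, Fubini;
* **`HypStrip.setIntegral_uhp_band_eq`** —
  `∫_{im z>0} f(z) 𝟙_{[0,|ℓ|)}(log|w z|) (i b'(arg w z) \overline{ζ'(z)}) dx dy = sign(ℓ) {∞, δ∞}_f/(2π)`
  (`i b'(arg w)\overline{ζ'} = 2∂B₀/∂z̄`).

## References

* [FarkasKra1992] H. M. Farkas, I. Kra, *Riemann Surfaces*, II.3.3 (the closed differential
  `η_c` of a simple closed curve, built in an annulus around it), III.1.1 (1.1.1).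
* [Beardon1983] A. F. Beardon, *The Geometry of Discrete Groups*, GTM 91 (1983), §4.3
  (hyperbolic elements, axes, conjugation to `z ↦ κz`); S. Katok, *Fuchsian Groups*, §2.1.
* [Manin1972] Ju. I. Manin, *Parabolic points and zeta functions of modular curves*, Prop. 1.4
  (`{τ, δτ}_f` is independent of `τ`).
-/

noncomputable section

open MeasureTheory Set Filter Topology Complex CongruenceSubgroup
open scoped ComplexConjugate UpperHalfPlane MatrixGroups ModularForm Real

namespace Literature.NumberTheory.EllipticCurves.ModularForms

namespace HypStrip

/-! ### The coordinate `w(z) = (z - ξ₁)/(z - ξ₂)` of a pair of real points `ξ₂ < ξ₁` -/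

section W

variable {ξ₁ ξ₂ : ℝ}

/-- `im w(z) = (ξ₁ - ξ₂) im z / |z - ξ₂|²`. [folklore] -/
theorem im_w (z : ℂ) (hz : z ≠ ξ₂) :
    (((z - ξ₁) / (z - ξ₂)).im) = (ξ₁ - ξ₂) * z.im / Complex.normSq (z - ξ₂) := by
  have h0 : z - ξ₂ ≠ 0 := sub_ne_zero.mpr hz
  rw [Complex.div_im]
  simp only [Complex.sub_re, Complex.ofReal_re, Complex.sub_im, Complex.ofReal_im, sub_zero]
  field_simp
  ring

/-- For `im z > 0` the point `z` is not the real number `ξ`. [folklore] -/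
theorem ne_ofReal_of_im_pos {z : ℂ} (hz : 0 < z.im) (ξ : ℝ) : z ≠ (ξ : ℂ) := by
  intro h; rw [h, Complex.ofReal_im] at hz; exact lt_irrefl _ hz

/-- `z - ξ ≠ 0` for `im z > 0`, `ξ` real. [folklore] -/
theorem sub_ofReal_ne_zero {z : ℂ} (hz : 0 < z.im) (ξ : ℝ) : z - (ξ : ℂ) ≠ 0 :=
  sub_ne_zero.mpr (ne_ofReal_of_im_pos hz ξ)

/-- **`w` maps the upper half-plane to itself** when `ξ₂ < ξ₁`. [folklore] -/
theorem im_w_pos (hξ : ξ₂ < ξ₁) {z : ℂ} (hz : 0 < z.im) : 0 < ((z - ξ₁) / (z - ξ₂)).im := by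
  rw [im_w z (ne_ofReal_of_im_pos hz ξ₂)]
  have h1 : 0 < Complex.normSq (z - ξ₂) := Complex.normSq_pos.mpr (sub_ofReal_ne_zero hz ξ₂)
  have h2 : 0 < ξ₁ - ξ₂ := sub_pos.mpr hξ
  positivity

/-- `w(z) ≠ 0` on the upper half-plane. [folklore] -/
theorem w_ne_zero (hξ : ξ₂ < ξ₁) {z : ℂ} (hz : 0 < z.im) : (z - ξ₁) / (z - ξ₂) ≠ 0 := by
  intro h; have := im_w_pos hξ hz; rw [h, Complex.zero_im] at this; exact lt_irrefl _ this

/-- `w(z)` lies in the slit plane on the upper half-plane. [folklore] -/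
theorem w_mem_slitPlane (hξ : ξ₂ < ξ₁) {z : ℂ} (hz : 0 < z.im) :
    (z - ξ₁) / (z - ξ₂) ∈ Complex.slitPlane :=
  Complex.mem_slitPlane_iff.mpr (Or.inr (im_w_pos hξ hz).ne')

/-- **Derivative of `w`**: `w'(z) = (ξ₁ - ξ₂)/(z - ξ₂)²`. [folklore] -/
theorem hasDerivAt_w {z : ℂ} (hz : 0 < z.im) :
    HasDerivAt (fun z : ℂ ↦ (z - ξ₁) / (z - ξ₂)) ((ξ₁ - ξ₂ : ℂ) / (z - ξ₂) ^ 2) z := by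
  have h0 := sub_ofReal_ne_zero hz ξ₂
  have hn : HasDerivAt (fun z : ℂ ↦ z - ξ₁) 1 z := (hasDerivAt_id z).sub_const _
  have hd : HasDerivAt (fun z : ℂ ↦ z - ξ₂) 1 z := (hasDerivAt_id z).sub_const _
  refine (hn.div hd h0).congr_deriv ?_
  field_simp
  ring

/-- **The strip coordinate `ζ = log w` is holomorphic on the upper half-plane** with
`ζ'(z) = w'/w = 1/(z - ξ₁) - 1/(z - ξ₂)`. [folklore] -/
theorem hasDerivAt_log_w (hξ : ξ₂ < ξ₁) {z : ℂ} (hz : 0 < z.im) :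
    HasDerivAt (fun z : ℂ ↦ Complex.log ((z - ξ₁) / (z - ξ₂)))
      (1 / (z - ξ₁) - 1 / (z - ξ₂)) z := by
  have h1 := sub_ofReal_ne_zero hz ξ₁
  have h2 := sub_ofReal_ne_zero hz ξ₂
  refine ((hasDerivAt_w hz).clog (w_mem_slitPlane hξ hz)).congr_deriv ?_
  field_simp
  ring

/-- The angle `Θ = arg w = im ζ` lies in `(0, π)` on the upper half-plane. [folklore] -/
theorem arg_w_mem_Ioo (hξ : ξ₂ < ξ₁) {z : ℂ} (hz : 0 < z.im) :
    Complex.arg ((z - ξ₁) / (z - ξ₂)) ∈ Ioo 0 π := by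
  have him := im_w_pos hξ hz
  refine ⟨lt_of_le_of_ne (Complex.arg_nonneg_iff.mpr him.le) ?_, Complex.arg_lt_pi_iff.mpr (Or.inr him.ne')⟩
  intro h0
  rw [eq_comm, Complex.arg_eq_zero_iff] at h0
  exact him.ne' h0.2

end W

/-! ### The inverse map `z(ζ) = (ξ₂ e^ζ - ξ₁)/(e^ζ - 1)` on the strip `0 < im ζ < π` -/

section Inv

variable {ξ₁ ξ₂ : ℝ}

/-- `im e^ζ > 0` on the strip `0 < im ζ < π`. [folklore] -/
theorem exp_im_pos {ζ : ℂ} (h0 : 0 < ζ.im) (hπ : ζ.im < π) : 0 < (Complex.exp ζ).im := by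
  rw [Complex.exp_im]
  exact mul_pos (Real.exp_pos _) (Real.sin_pos_of_pos_of_lt_pi h0 hπ)

/-- `e^ζ ≠ 1` on the strip. [folklore] -/
theorem exp_sub_one_ne_zero {ζ : ℂ} (h0 : 0 < ζ.im) (hπ : ζ.im < π) : Complex.exp ζ - 1 ≠ 0 := by
  intro h
  have := exp_im_pos h0 hπ
  rw [sub_eq_zero.mp h, Complex.one_im] at this
  exact lt_irrefl _ this

/-- The Möbius map `u ↦ (ξ₂ u - ξ₁)/(u - 1)` (matrix `(ξ₂ -ξ₁; 1 -1)` of determinant `ξ₁ - ξ₂`)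
has imaginary part `(ξ₁ - ξ₂) im u / |u - 1|²`. [folklore] -/
theorem im_moebInv (u : ℂ) (_hu : u - 1 ≠ 0) :
    ((ξ₂ * u - ξ₁) / (u - 1)).im = (ξ₁ - ξ₂) * u.im / Complex.normSq (u - 1) := by
  rw [Complex.div_im]
  simp only [Complex.sub_re, Complex.mul_re, Complex.ofReal_re, Complex.ofReal_im, zero_mul,
    sub_zero, Complex.one_re, Complex.sub_im, Complex.mul_im, add_zero, Complex.one_im]
  field_simp
  ring

/-- **`z(ζ)` lies in the upper half-plane** for `ζ` in the strip (`ξ₂ < ξ₁`). [folklore] -/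
theorem im_zInv_pos (hξ : ξ₂ < ξ₁) {ζ : ℂ} (h0 : 0 < ζ.im) (hπ : ζ.im < π) :
    0 < ((ξ₂ * Complex.exp ζ - ξ₁) / (Complex.exp ζ - 1)).im := by
  have hu := exp_sub_one_ne_zero h0 hπ
  rw [im_moebInv _ hu]
  have h1 : 0 < Complex.normSq (Complex.exp ζ - 1) := Complex.normSq_pos.mpr hu
  have h2 : 0 < ξ₁ - ξ₂ := sub_pos.mpr hξ
  have h3 := exp_im_pos h0 hπ
  positivity

/-- **`w(z(ζ)) = e^ζ`**. [folklore] -/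
theorem w_zInv (hξ : ξ₂ < ξ₁) {ζ : ℂ} (h0 : 0 < ζ.im) (hπ : ζ.im < π) :
    ((ξ₂ * Complex.exp ζ - ξ₁) / (Complex.exp ζ - 1) - ξ₁) /
        ((ξ₂ * Complex.exp ζ - ξ₁) / (Complex.exp ζ - 1) - ξ₂) = Complex.exp ζ := by
  have hu := exp_sub_one_ne_zero h0 hπ
  have hξ0 : (ξ₂ : ℂ) - ξ₁ ≠ 0 := by
    rw [sub_ne_zero]; exact_mod_cast hξ.ne
  have hden : (ξ₂ * Complex.exp ζ - ξ₁) / (Complex.exp ζ - 1) - ξ₂ ≠ 0 := by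
    rw [div_sub' hu, div_ne_zero_iff]
    refine ⟨?_, hu⟩
    have : (ξ₂ : ℂ) * Complex.exp ζ - ξ₁ - (Complex.exp ζ - 1) * ξ₂ = ξ₂ - ξ₁ := by ring
    rw [this]; exact hξ0
  rw [div_eq_iff hden]
  field_simp
  ring

/-- **`ζ(z(ζ)) = ζ`** on the strip (`log e^ζ = ζ` for `|im ζ| < π`). [folklore] -/
theorem log_w_zInv (hξ : ξ₂ < ξ₁) {ζ : ℂ} (h0 : 0 < ζ.im) (hπ : ζ.im < π) :
    Complex.log (((ξ₂ * Complex.exp ζ - ξ₁) / (Complex.exp ζ - 1) - ξ₁) /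
        ((ξ₂ * Complex.exp ζ - ξ₁) / (Complex.exp ζ - 1) - ξ₂)) = ζ := by
  rw [w_zInv hξ h0 hπ, Complex.log_exp (by linarith) hπ.le]

/-- **`z(ζ(z)) = z`** on the upper half-plane. [folklore] -/
theorem zInv_log_w (hξ : ξ₂ < ξ₁) {z : ℂ} (hz : 0 < z.im) :
    (ξ₂ * Complex.exp (Complex.log ((z - ξ₁) / (z - ξ₂))) - ξ₁) /
        (Complex.exp (Complex.log ((z - ξ₁) / (z - ξ₂))) - 1) = z := by
  rw [Complex.exp_log (w_ne_zero hξ hz)]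
  have h1 := sub_ofReal_ne_zero hz ξ₁
  have h2 := sub_ofReal_ne_zero hz ξ₂
  have hξ0 : (ξ₂ : ℂ) - ξ₁ ≠ 0 := by
    rw [sub_ne_zero]; exact_mod_cast hξ.ne
  have hden : (z - ξ₁) / (z - ξ₂) - 1 ≠ 0 := by
    rw [div_sub_one h2, div_ne_zero_iff]
    refine ⟨?_, h2⟩
    have : z - ξ₁ - (z - ξ₂) = ξ₂ - ξ₁ := by ring
    rw [this]; exact hξ0
  rw [div_eq_iff hden]
  field_simp
  ring

/-- **Derivative of `z(ζ)`**: `z'(ζ) = (ξ₁ - ξ₂) e^ζ/(e^ζ - 1)²`. [folklore] -/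
theorem hasDerivAt_zInv {ζ : ℂ} (h0 : 0 < ζ.im) (hπ : ζ.im < π) :
    HasDerivAt (fun ζ : ℂ ↦ (ξ₂ * Complex.exp ζ - ξ₁) / (Complex.exp ζ - 1))
      ((ξ₁ - ξ₂ : ℂ) * Complex.exp ζ / (Complex.exp ζ - 1) ^ 2) ζ := by
  have hu := exp_sub_one_ne_zero h0 hπ
  have hn : HasDerivAt (fun ζ : ℂ ↦ (ξ₂ : ℂ) * Complex.exp ζ - ξ₁) ((ξ₂ : ℂ) * Complex.exp ζ) ζ := by
    simpa using ((Complex.hasDerivAt_exp ζ).const_mul (ξ₂ : ℂ)).sub_const (ξ₁ : ℂ)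
  have hd : HasDerivAt (fun ζ : ℂ ↦ Complex.exp ζ - 1) (Complex.exp ζ) ζ :=
    (Complex.hasDerivAt_exp ζ).sub_const 1
  refine (hn.div hd hu).congr_deriv ?_
  field_simp
  ring

/-- `z'(ζ) ≠ 0` on the strip. [folklore] -/
theorem zInv_deriv_ne_zero (hξ : ξ₂ < ξ₁) {ζ : ℂ} (h0 : 0 < ζ.im) (hπ : ζ.im < π) :
    (ξ₁ - ξ₂ : ℂ) * Complex.exp ζ / (Complex.exp ζ - 1) ^ 2 ≠ 0 := by
  have hu := exp_sub_one_ne_zero h0 hπ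
  have hξ0 : (ξ₁ : ℂ) - ξ₂ ≠ 0 := by
    rw [sub_ne_zero]; exact_mod_cast hξ.ne'
  exact div_ne_zero (mul_ne_zero hξ0 (Complex.exp_ne_zero ζ)) (pow_ne_zero 2 hu)

/-- **`ζ'(z(ζ)) · z'(ζ) = 1`**: the chain rule for `ζ ∘ z = id`, as an identity of the explicit
derivatives. [folklore] -/
theorem logDeriv_w_zInv_mul (hξ : ξ₂ < ξ₁) {ζ : ℂ} (h0 : 0 < ζ.im) (hπ : ζ.im < π) :
    (1 / ((ξ₂ * Complex.exp ζ - ξ₁) / (Complex.exp ζ - 1) - ξ₁) -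
        1 / ((ξ₂ * Complex.exp ζ - ξ₁) / (Complex.exp ζ - 1) - ξ₂)) *
      ((ξ₁ - ξ₂ : ℂ) * Complex.exp ζ / (Complex.exp ζ - 1) ^ 2) = 1 := by
  have hu := exp_sub_one_ne_zero h0 hπ
  have he := Complex.exp_ne_zero ζ
  have hξ0 : (ξ₂ : ℂ) - ξ₁ ≠ 0 := by
    rw [sub_ne_zero]; exact_mod_cast hξ.ne
  have e1 : (ξ₂ * Complex.exp ζ - ξ₁) / (Complex.exp ζ - 1) - ξ₁ =
      (ξ₂ - ξ₁) * Complex.exp ζ / (Complex.exp ζ - 1) := by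
    field_simp; ring
  have e2 : (ξ₂ * Complex.exp ζ - ξ₁) / (Complex.exp ζ - 1) - ξ₂ =
      (ξ₂ - ξ₁) / (Complex.exp ζ - 1) := by
    field_simp; ring
  rw [e1, e2]
  field_simp
  ring

end Inv

/-! ### Adapted coordinates of a hyperbolic element of `SL(2, ℤ)` -/

section Hyperbolic

/-- **Fixed points and multiplier of a hyperbolic element.** If `δ = (a b; c d) ∈ SL(2, ℤ)` has
`(a + d)² > 4` then there are real `ξ₂ < ξ₁` (the fixed points, roots of `cξ² + (d - a)ξ - b`) and
`κ > 0`, `κ ≠ 1` (the square of an eigenvalue) such that the coordinate `w(z) = (z - ξ₁)/(z - ξ₂)`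
conjugates `δ` to the homothety `w ↦ κ w` on the upper half-plane:
`w(δz) = κ w(z)` (Beardon, *The geometry of discrete groups*, §4.3; Katok, *Fuchsian groups*, §2.1:
hyperbolic elements are conjugate to `z ↦ κz`). [cite: Beardon1983, §4.3 (hyperbolic elements)] -/
theorem exists_coords_of_hyperbolic (δ : SL(2, ℤ)) (hδ : 4 < (δ 0 0 + δ 1 1) ^ 2) :
    ∃ ξ₁ ξ₂ κ : ℝ, ξ₂ < ξ₁ ∧ 0 < κ ∧ κ ≠ 1 ∧
      ∀ z : ℂ, 0 < z.im →
        (moebius δ z - ξ₁) / (moebius δ z - ξ₂) = κ * ((z - ξ₁) / (z - ξ₂)) := by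
  -- real entries
  set a : ℝ := ((δ 0 0 : ℤ) : ℝ) with ha
  set b : ℝ := ((δ 0 1 : ℤ) : ℝ) with hb
  set c : ℝ := ((δ 1 0 : ℤ) : ℝ) with hc
  set d : ℝ := ((δ 1 1 : ℤ) : ℝ) with hd
  have hdet : a * d - b * c = 1 := by
    have h := Matrix.SpecialLinearGroup.det_coe δ
    rw [Matrix.det_fin_two] at h
    have h' : ((δ 0 0 : ℤ) : ℝ) * (δ 1 1 : ℤ) - (δ 0 1 : ℤ) * (δ 1 0 : ℤ) = 1 := by exact_mod_cast h
    simp only [ha, hb, hc, hd]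
    linarith
  have htr : 4 < (a + d) ^ 2 := by
    have : ((4 : ℤ) : ℝ) < (((δ 0 0 + δ 1 1) ^ 2 : ℤ) : ℝ) := by exact_mod_cast hδ
    push_cast at this
    simpa [ha, hd] using this
  have hc0 : c ≠ 0 := by
    intro h0
    have had : a * d = 1 := by rw [h0, mul_zero, sub_zero] at hdet; exact hdet
    -- `a, d` are integers with `ad = 1`, so `a = d = ±1`
    have hai : ∃ m : ℤ, (m : ℝ) = a := ⟨δ 0 0, rfl⟩
    have hdi : ∃ m : ℤ, (m : ℝ) = d := ⟨δ 1 1, rfl⟩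
    obtain ⟨m, hm⟩ := hai
    obtain ⟨n, hn⟩ := hdi
    have hmn : m * n = 1 := by
      have : ((m * n : ℤ) : ℝ) = 1 := by push_cast; rw [hm, hn, had]
      exact_mod_cast this
    rcases Int.eq_one_or_neg_one_of_mul_eq_one hmn with rfl | rfl
    · have : n = 1 := by simpa using hmn
      subst this
      rw [← hm, ← hn] at htr; norm_num at htr
    · have : n = -1 := by linarith
      subst this
      rw [← hm, ← hn] at htr; norm_num at htr
  -- the roots
  set D : ℝ := (a + d) ^ 2 - 4 with hD
  have hD0 : 0 < D := by rw [hD]; linarith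
  set s : ℝ := Real.sqrt D with hs
  have hs2 : s ^ 2 = D := Real.sq_sqrt hD0.le
  have hs0 : 0 < s := Real.sqrt_pos.mpr hD0
  set r₁ : ℝ := ((a - d) + s) / (2 * c) with hr₁
  set r₂ : ℝ := ((a - d) - s) / (2 * c) with hr₂
  have hroot : ∀ r : ℝ, (r = r₁ ∨ r = r₂) → b - r * d = -r * (a - c * r) := by
    intro r hr
    -- `c r² + (d - a) r - b = 0`
    have key : c * r ^ 2 + (d - a) * r - b = 0 := by
      rcases hr with rfl | rfl
      · rw [hr₁]; field_simp; nlinarith [hs2, hdet]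
      · rw [hr₂]; field_simp; nlinarith [hs2, hdet]
    linear_combination -key
  have hsum : r₁ + r₂ = (a - d) / c := by rw [hr₁, hr₂]; field_simp; ring
  have hne : r₁ ≠ r₂ := by
    intro h; rw [hr₁, hr₂, div_eq_div_iff (by positivity) (by positivity)] at h
    have : s = 0 := by
      have h2 : (a - d + s) = (a - d - s) := by
        have h3 := mul_right_cancel₀ (by positivity : (2 * c) ≠ 0) h
        linarith
      linarith
    exact hs0.ne' this
  -- order them
  obtain ⟨ξ₁, ξ₂, hξ, h₁, h₂, hsum'⟩ : ∃ ξ₁ ξ₂ : ℝ, ξ₂ < ξ₁ ∧ (ξ₁ = r₁ ∨ ξ₁ = r₂) ∧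
      (ξ₂ = r₁ ∨ ξ₂ = r₂) ∧ ξ₁ + ξ₂ = (a - d) / c := by
    rcases lt_or_gt_of_ne hne with h | h
    · exact ⟨r₂, r₁, h, Or.inr rfl, Or.inl rfl, by rw [add_comm, hsum]⟩
    · exact ⟨r₁, r₂, h, Or.inl rfl, Or.inr rfl, hsum⟩
  set l₁ : ℝ := a - c * ξ₁ with hl₁
  set l₂ : ℝ := a - c * ξ₂ with hl₂
  have e₁ : b - ξ₁ * d = -ξ₁ * l₁ := hroot ξ₁ h₁
  have e₂ : b - ξ₂ * d = -ξ₂ * l₂ := hroot ξ₂ h₂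
  have hl₁₂ : l₁ * l₂ = 1 := by
    -- `(a - cξ₁)(a - cξ₂) = a² - ac(ξ₁ + ξ₂) + c²ξ₁ξ₂ = ad - bc`
    have hprod : c * (ξ₁ * ξ₂) = -b := by
      -- from the two root identities: `b - ξd = -ξa + cξ²`
      have f₁ : c * ξ₁ ^ 2 + (d - a) * ξ₁ - b = 0 := by rw [hl₁] at e₁; linear_combination -e₁
      have f₂ : c * ξ₂ ^ 2 + (d - a) * ξ₂ - b = 0 := by rw [hl₂] at e₂; linear_combination -e₂
      -- subtract: `c(ξ₁² - ξ₂²) + (d - a)(ξ₁ - ξ₂) = 0`, divide by `ξ₁ - ξ₂ ≠ 0`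
      have hξ0 : ξ₁ - ξ₂ ≠ 0 := sub_ne_zero.mpr hξ.ne'
      have g : c * (ξ₁ + ξ₂) + (d - a) = 0 := by
        have : (c * (ξ₁ + ξ₂) + (d - a)) * (ξ₁ - ξ₂) = 0 := by linear_combination f₁ - f₂
        exact (mul_eq_zero.mp this).resolve_right hξ0
      -- then `b = cξ₁² + (d-a)ξ₁ = cξ₁² - cξ₁(ξ₁+ξ₂) = -cξ₁ξ₂`
      linear_combination -f₁ + ξ₁ * g
    have : l₁ * l₂ = a ^ 2 - a * (c * (ξ₁ + ξ₂)) + c * (c * (ξ₁ * ξ₂)) := by rw [hl₁, hl₂]; ring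
    rw [this, hprod, hsum']
    field_simp
    linear_combination hdet
  have hl₁0 : l₁ ≠ 0 := fun h ↦ by rw [h, zero_mul] at hl₁₂; exact zero_ne_one hl₁₂
  refine ⟨ξ₁, ξ₂, l₁ ^ 2, hξ, by positivity, ?_, fun z hz ↦ ?_⟩
  · -- `l₁² = 1` would force `a + d = l₁ + l₂ = ±2`
    intro h1
    have hl : l₁ = 1 ∨ l₁ = -1 := by
      have : (l₁ - 1) * (l₁ + 1) = 0 := by linear_combination h1
      rcases mul_eq_zero.mp this with h | h
      · exact Or.inl (by linarith)
      · exact Or.inr (by linarith)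
    have hsuml : l₁ + l₂ = a + d := by
      rw [hl₁, hl₂]
      have : c * (ξ₁ + ξ₂) = a - d := by rw [hsum']; field_simp
      linarith
    rcases hl with h | h
    · have : l₂ = 1 := by rw [h, one_mul] at hl₁₂; exact hl₁₂
      have : a + d = 2 := by linarith
      rw [this] at htr; norm_num at htr
    · have : l₂ = -1 := by rw [h] at hl₁₂; linarith
      have : a + d = -2 := by linarith
      rw [this] at htr; norm_num at htr
  · -- the conjugation identity
    have hcd : (c : ℂ) * z + d ≠ 0 := by
      have := moebius_denom_ne_zero δ hz
      simpa [hc, hd] using this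
    have hz₁ := sub_ofReal_ne_zero hz ξ₁
    have hz₂ := sub_ofReal_ne_zero hz ξ₂
    have hM : moebius δ z = ((a : ℂ) * z + b) / ((c : ℂ) * z + d) := by
      simp [moebius, ha, hb, hc, hd]
    have e₁C : (b : ℂ) - ξ₁ * d = -ξ₁ * l₁ := by exact_mod_cast e₁
    have e₂C : (b : ℂ) - ξ₂ * d = -ξ₂ * l₂ := by exact_mod_cast e₂
    have hl₁C : ((l₁ : ℝ) : ℂ) = a - c * ξ₁ := by rw [hl₁]; push_cast; ring
    have hl₂C : ((l₂ : ℝ) : ℂ) = a - c * ξ₂ := by rw [hl₂]; push_cast; ring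
    have hM₁ : moebius δ z - ξ₁ = (l₁ : ℂ) * (z - ξ₁) / ((c : ℂ) * z + d) := by
      rw [hM, div_sub' hcd]
      congr 1
      linear_combination e₁C - z * hl₁C
    have hM₂ : moebius δ z - ξ₂ = (l₂ : ℂ) * (z - ξ₂) / ((c : ℂ) * z + d) := by
      rw [hM, div_sub' hcd]
      congr 1
      linear_combination e₂C - z * hl₂C
    have hl₂0 : (l₂ : ℂ) ≠ 0 := by
      intro h
      have : l₂ = 0 := by exact_mod_cast h
      rw [this, mul_zero] at hl₁₂; exact zero_ne_one hl₁₂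
    have hl₁₂C : (l₁ : ℂ) * l₂ = 1 := by exact_mod_cast hl₁₂
    rw [hM₁, hM₂, div_div_div_cancel_right₀ hcd, div_eq_iff (mul_ne_zero hl₂0 hz₂)]
    push_cast
    field_simp
    linear_combination (-(l₁ : ℂ)) * hl₁₂C

variable {ξ₁ ξ₂ κ : ℝ} {δ : SL(2, ℤ)}

/-- **`w` is injective on the upper half-plane** (it has the left inverse `z(log ·)`). [folklore] -/
theorem w_injOn (hξ : ξ₂ < ξ₁) {z z' : ℂ} (hz : 0 < z.im) (hz' : 0 < z'.im)
    (h : (z - ξ₁) / (z - ξ₂) = (z' - ξ₁) / (z' - ξ₂)) : z = z' := by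
  rw [← zInv_log_w hξ hz, ← zInv_log_w hξ hz', h]

/-- **Equivariance of the strip coordinate**: `ζ(δz) = ζ(z) + log κ`. [folklore] -/
theorem log_w_moebius (hξ : ξ₂ < ξ₁) (hκ : 0 < κ)
    (hw : ∀ z : ℂ, 0 < z.im → (moebius δ z - ξ₁) / (moebius δ z - ξ₂) = κ * ((z - ξ₁) / (z - ξ₂)))
    {z : ℂ} (hz : 0 < z.im) :
    Complex.log ((moebius δ z - ξ₁) / (moebius δ z - ξ₂)) =
      Complex.log ((z - ξ₁) / (z - ξ₂)) + Real.log κ := by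
  rw [hw z hz, Complex.log_ofReal_mul hκ (w_ne_zero hξ hz), add_comm]

/-- **The angle is invariant**: `Θ(δz) = Θ(z)`. [folklore] -/
theorem arg_w_moebius (hξ : ξ₂ < ξ₁) (hκ : 0 < κ)
    (hw : ∀ z : ℂ, 0 < z.im → (moebius δ z - ξ₁) / (moebius δ z - ξ₂) = κ * ((z - ξ₁) / (z - ξ₂)))
    {z : ℂ} (hz : 0 < z.im) :
    Complex.arg ((moebius δ z - ξ₁) / (moebius δ z - ξ₂)) = Complex.arg ((z - ξ₁) / (z - ξ₂)) := by
  have h := congrArg Complex.im (log_w_moebius hξ hκ hw hz)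
  simpa [Complex.log_im] using h

/-- **The radial coordinate shifts**: `log |w(δz)| = log |w(z)| + log κ`. [folklore] -/
theorem log_norm_w_moebius (hξ : ξ₂ < ξ₁) (hκ : 0 < κ)
    (hw : ∀ z : ℂ, 0 < z.im → (moebius δ z - ξ₁) / (moebius δ z - ξ₂) = κ * ((z - ξ₁) / (z - ξ₂)))
    {z : ℂ} (hz : 0 < z.im) :
    Real.log ‖(moebius δ z - ξ₁) / (moebius δ z - ξ₂)‖ = Real.log ‖(z - ξ₁) / (z - ξ₂)‖ + Real.log κ := by
  have h := congrArg Complex.re (log_w_moebius hξ hκ hw hz)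
  simpa [Complex.log_re] using h

/-- **`z(ζ + log κ) = δ · z(ζ)`**: in the strip coordinate `δ` is the translation by `log κ`. [folklore] -/
theorem zInv_add_log (hξ : ξ₂ < ξ₁) (hκ : 0 < κ)
    (hw : ∀ z : ℂ, 0 < z.im → (moebius δ z - ξ₁) / (moebius δ z - ξ₂) = κ * ((z - ξ₁) / (z - ξ₂)))
    {ζ : ℂ} (h0 : 0 < ζ.im) (hπ : ζ.im < π) :
    (ξ₂ * Complex.exp (ζ + Real.log κ) - ξ₁) / (Complex.exp (ζ + Real.log κ) - 1) =
      moebius δ ((ξ₂ * Complex.exp ζ - ξ₁) / (Complex.exp ζ - 1)) := by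
  have h0' : 0 < (ζ + Real.log κ).im := by simpa using h0
  have hπ' : (ζ + Real.log κ).im < π := by simpa using hπ
  have hz := im_zInv_pos hξ h0 hπ
  refine w_injOn hξ (im_zInv_pos hξ h0' hπ') (moebius_im_pos δ hz) ?_
  rw [w_zInv hξ h0' hπ', hw _ hz, w_zInv hξ h0 hπ, Complex.exp_add, Complex.ofReal_log hκ.le,
    Complex.exp_log (Complex.ofReal_ne_zero.mpr hκ.ne'), mul_comm]

end Hyperbolic

/-! ### The band function `b(θ) = smoothTransition((θ - (π/2 - ε))/(2ε))` -/

section Band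

variable {ε : ℝ}

/-- The band function is smooth. [folklore] -/
theorem contDiff_band :
    ContDiff ℝ 1 (fun θ : ℝ ↦ Real.smoothTransition ((θ - (π / 2 - ε)) / (2 * ε))) :=
  (Real.smoothTransition.contDiff (n := 1)).comp ((contDiff_id.sub contDiff_const).div_const _)

/-- `b = 0` below the band. [folklore] -/
theorem band_eq_zero (hε : 0 < ε) {θ : ℝ} (hθ : θ ≤ π / 2 - ε) :
    Real.smoothTransition ((θ - (π / 2 - ε)) / (2 * ε)) = 0 :=
  Real.smoothTransition.zero_of_nonpos (div_nonpos_of_nonpos_of_nonneg (by linarith) (by linarith))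

/-- `b = 1` above the band. [folklore] -/
theorem band_eq_one (hε : 0 < ε) {θ : ℝ} (hθ : π / 2 + ε ≤ θ) :
    Real.smoothTransition ((θ - (π / 2 - ε)) / (2 * ε)) = 1 :=
  Real.smoothTransition.one_of_one_le (by rw [le_div_iff₀ (by linarith)]; linarith)

/-- `b(0) = 0` and `b(π) = 1` for `0 < ε < π/2`. [folklore] -/
theorem band_zero_pi (hε : 0 < ε) (hε' : ε < π / 2) :
    Real.smoothTransition (((0 : ℝ) - (π / 2 - ε)) / (2 * ε)) = 0 ∧
      Real.smoothTransition ((π - (π / 2 - ε)) / (2 * ε)) = 1 :=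
  ⟨band_eq_zero hε (by linarith), band_eq_one hε (by linarith)⟩

/-- **The derivative of the band function is supported in the band** `[π/2 - ε, π/2 + ε]`. [folklore] -/
theorem deriv_band_eq_zero (hε : 0 < ε) {θ : ℝ} (hθ : θ ∉ Icc (π / 2 - ε) (π / 2 + ε)) :
    deriv (fun θ : ℝ ↦ Real.smoothTransition ((θ - (π / 2 - ε)) / (2 * ε))) θ = 0 := by
  rw [mem_Icc, not_and_or, not_le, not_le] at hθ
  rcases hθ with h | h
  · -- locally `b = 0`
    have hev : (fun θ : ℝ ↦ Real.smoothTransition ((θ - (π / 2 - ε)) / (2 * ε))) =ᶠ[𝓝 θ]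
        fun _ ↦ (0 : ℝ) := by
      filter_upwards [Iio_mem_nhds h] with t ht using band_eq_zero hε ht.le
    rw [hev.deriv_eq, deriv_const]
  · have hev : (fun θ : ℝ ↦ Real.smoothTransition ((θ - (π / 2 - ε)) / (2 * ε))) =ᶠ[𝓝 θ]
        fun _ ↦ (1 : ℝ) := by
      filter_upwards [Ioi_mem_nhds h] with t ht using band_eq_one hε ht.le
    rw [hev.deriv_eq, deriv_const]

/-- `∫₀^π b' = b(π) - b(0) = 1`. [folklore] -/
theorem integral_deriv_band (hε : 0 < ε) (hε' : ε < π / 2) :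
    ∫ θ in (0 : ℝ)..π, deriv (fun θ : ℝ ↦ Real.smoothTransition ((θ - (π / 2 - ε)) / (2 * ε))) θ = 1 := by
  have hd := contDiff_band (ε := ε)
  rw [intervalIntegral.integral_deriv_eq_sub (fun x _ ↦ (hd.differentiable one_ne_zero).differentiableAt)
    ((hd.continuous_deriv le_rfl).intervalIntegrable _ _)]
  obtain ⟨h0, hπ⟩ := band_zero_pi hε hε'
  rw [h0, hπ]; norm_num

/-- The derivative of the band function is continuous and bounded. [folklore] -/
theorem exists_bound_deriv_band (hε : 0 < ε) :
    ∃ B : ℝ, ∀ θ, |deriv (fun θ : ℝ ↦ Real.smoothTransition ((θ - (π / 2 - ε)) / (2 * ε))) θ| ≤ B := by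
  have hc := (contDiff_band (ε := ε)).continuous_deriv le_rfl
  -- continuous with compact support
  obtain ⟨B, hB⟩ := (isCompact_Icc (a := π / 2 - ε) (b := π / 2 + ε)).exists_bound_of_continuousOn
    hc.continuousOn
  refine ⟨max B 0, fun θ ↦ ?_⟩
  by_cases hθ : θ ∈ Icc (π / 2 - ε) (π / 2 + ε)
  · exact ((Real.norm_eq_abs _).symm.le.trans (hB θ hθ)).trans (le_max_left _ _)
  · rw [deriv_band_eq_zero hε hθ, abs_zero]; exact le_max_right _ _

end Band

/-! ### The inner integral: `∫₀^{|ℓ|} f(z(ρ + iθ)) z'(ρ + iθ) dρ = ± {∞, δ∞}_f / (2πi)` -/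

section Inner

variable {N : ℕ} [NeZero N] {ξ₁ ξ₂ κ : ℝ} {δ : SL(2, ℤ)}

/-- Along the horizontal line `ρ ↦ ρ + iθ` of the strip, the Eichler integral of `f` at
`z(ρ + iθ)` has derivative `2πi f(z) z'`. [folklore] -/
theorem hasDerivAt_eichler_zInv_line (f : CuspForm (Gamma0 N) 2) (hξ : ξ₂ < ξ₁) {θ : ℝ}
    (hθ : θ ∈ Ioo 0 π) (ρ : ℝ) :
    HasDerivAt (fun ρ : ℝ ↦ eichlerIntegral f (UpperHalfPlane.ofComplex
        ((ξ₂ * Complex.exp ((ρ : ℂ) + θ * I) - ξ₁) / (Complex.exp ((ρ : ℂ) + θ * I) - 1))))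
      (2 * π * I * f (UpperHalfPlane.ofComplex
          ((ξ₂ * Complex.exp ((ρ : ℂ) + θ * I) - ξ₁) / (Complex.exp ((ρ : ℂ) + θ * I) - 1))) *
        ((ξ₁ - ξ₂ : ℂ) * Complex.exp ((ρ : ℂ) + θ * I) / (Complex.exp ((ρ : ℂ) + θ * I) - 1) ^ 2)) ρ := by
  have hζ0 : 0 < ((ρ : ℂ) + θ * I).im := by simpa using hθ.1
  have hζπ : ((ρ : ℂ) + θ * I).im < π := by simpa using hθ.2
  have hline : HasDerivAt (fun r : ℝ ↦ (r : ℂ) + θ * I) 1 ρ := by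
    simpa using (hasDerivAt_id ρ).ofReal_comp.add_const ((θ : ℂ) * I)
  have hz : HasDerivAt (fun ζ : ℂ ↦ (ξ₂ * Complex.exp ζ - ξ₁) / (Complex.exp ζ - 1))
      ((ξ₁ - ξ₂ : ℂ) * Complex.exp ((ρ : ℂ) + θ * I) / (Complex.exp ((ρ : ℂ) + θ * I) - 1) ^ 2)
      ((fun r : ℝ ↦ (r : ℂ) + θ * I) ρ) :=
    hasDerivAt_zInv hζ0 hζπ
  have hE := hasDerivAt_eichlerIntegral f (im_zInv_pos hξ hζ0 hζπ)
  have h1 := hz.comp ρ hline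
  have h2 := hE.comp ρ h1
  rw [mul_one] at h2
  exact h2

omit [NeZero N] in
/-- A cusp form composed with a continuous curve in the upper half-plane is continuous. [folklore] -/
theorem continuous_cuspForm_ofComplex_comp (f : CuspForm (Gamma0 N) 2) {Z : ℝ → ℂ} (hZ : Continuous Z)
    (hZim : ∀ ρ, 0 < (Z ρ).im) : Continuous fun ρ : ℝ ↦ f (UpperHalfPlane.ofComplex (Z ρ)) := by
  have h : (fun ρ : ℝ ↦ f (UpperHalfPlane.ofComplex (Z ρ))) = fun ρ ↦ f ⟨Z ρ, hZim ρ⟩ :=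
    funext fun ρ ↦ by rw [UpperHalfPlane.ofComplex_apply_of_im_pos (hZim ρ)]
  rw [h]
  refine (ModularFormClass.holo f).continuous.comp ?_
  exact UpperHalfPlane.isOpenEmbedding_coe.isEmbedding.continuous_iff.mpr (by simpa [Function.comp_def] using hZ)

/-- The horizontal line `ρ ↦ ρ + iθ`, `0 < θ < π`, stays in the strip. [folklore] -/
theorem line_im {θ : ℝ} (hθ : θ ∈ Ioo 0 π) (ρ : ℝ) :
    0 < ((ρ : ℂ) + θ * I).im ∧ ((ρ : ℂ) + θ * I).im < π := by
  constructor
  · simpa using hθ.1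
  · simpa using hθ.2

omit [NeZero N] in
/-- The integrand `f(z(ρ + iθ)) z'(ρ + iθ)` is continuous in `ρ`. [folklore] -/
theorem continuous_inner_integrand (f : CuspForm (Gamma0 N) 2) (hξ : ξ₂ < ξ₁) {θ : ℝ} (hθ : θ ∈ Ioo 0 π) :
    Continuous fun ρ : ℝ ↦ f (UpperHalfPlane.ofComplex
        ((ξ₂ * Complex.exp ((ρ : ℂ) + θ * I) - ξ₁) / (Complex.exp ((ρ : ℂ) + θ * I) - 1))) *
      ((ξ₁ - ξ₂ : ℂ) * Complex.exp ((ρ : ℂ) + θ * I) / (Complex.exp ((ρ : ℂ) + θ * I) - 1) ^ 2) := by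
  have hline : Continuous fun ρ : ℝ ↦ (ρ : ℂ) + θ * I := by fun_prop
  have hden : ∀ ρ : ℝ, Complex.exp ((ρ : ℂ) + θ * I) - 1 ≠ 0 := fun ρ ↦
    exp_sub_one_ne_zero (line_im hθ ρ).1 (line_im hθ ρ).2
  have hZ : Continuous fun ρ : ℝ ↦
      (ξ₂ * Complex.exp ((ρ : ℂ) + θ * I) - ξ₁) / (Complex.exp ((ρ : ℂ) + θ * I) - 1) :=
    ((continuous_const.mul (Complex.continuous_exp.comp hline)).sub continuous_const).div
      ((Complex.continuous_exp.comp hline).sub continuous_const) hden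
  have hZ' : Continuous fun ρ : ℝ ↦
      (ξ₁ - ξ₂ : ℂ) * Complex.exp ((ρ : ℂ) + θ * I) / (Complex.exp ((ρ : ℂ) + θ * I) - 1) ^ 2 :=
    (continuous_const.mul (Complex.continuous_exp.comp hline)).div
      (((Complex.continuous_exp.comp hline).sub continuous_const).pow 2) fun ρ ↦ pow_ne_zero 2 (hden ρ)
  exact (continuous_cuspForm_ofComplex_comp f hZ fun ρ ↦
    im_zInv_pos hξ (line_im hθ ρ).1 (line_im hθ ρ).2).mul hZ'

/-- **The inner integral.** For `θ ∈ (0, π)`: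
`∫₀^{|log κ|} f(z(ρ+iθ)) z'(ρ+iθ) dρ = sign(log κ) · {∞, δ∞}_f / (2πi)`: the integrand is the
derivative of `E(z(ρ + iθ))/(2πi)`, `E = 2πi∫_{i∞} f` (`hasDerivAt_eichlerIntegral`), and
`z(ζ + log κ) = δ z(ζ)` (`zInv_add_log`), so the integral is `±(E(δτ) - E(τ))/(2πi) = ±{∞, δ∞}_f/(2πi)`
(`eichlerIntegral_smul_sub_holds`: the period over `{τ, δτ}` does not depend on `τ`), the sign being
that of `log κ`. [folklore] -/
theorem inner_integral_eq (f : CuspForm (Gamma0 N) 2) (hδ : δ ∈ Gamma0 N) (hξ : ξ₂ < ξ₁) (hκ : 0 < κ)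
    (hκ1 : κ ≠ 1)
    (hw : ∀ z : ℂ, 0 < z.im → (moebius δ z - ξ₁) / (moebius δ z - ξ₂) = κ * ((z - ξ₁) / (z - ξ₂)))
    {θ : ℝ} (hθ : θ ∈ Ioo 0 π) :
    ∫ ρ in (0 : ℝ)..|Real.log κ|,
        f (UpperHalfPlane.ofComplex
            ((ξ₂ * Complex.exp ((ρ : ℂ) + θ * I) - ξ₁) / (Complex.exp ((ρ : ℂ) + θ * I) - 1))) *
          ((ξ₁ - ξ₂ : ℂ) * Complex.exp ((ρ : ℂ) + θ * I) / (Complex.exp ((ρ : ℂ) + θ * I) - 1) ^ 2) =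
      (if 0 < Real.log κ then (1 : ℂ) else -1) * cuspSymbol f ⟨δ, hδ⟩ / (2 * π * I) := by
  set ℓ : ℝ := Real.log κ with hℓ
  have hℓ0 : ℓ ≠ 0 := fun h ↦ hκ1 (Real.eq_one_of_pos_of_log_eq_zero hκ h)
  set Z : ℝ → ℂ := fun ρ ↦ (ξ₂ * Complex.exp ((ρ : ℂ) + θ * I) - ξ₁) / (Complex.exp ((ρ : ℂ) + θ * I) - 1)
    with hZ
  set Φ : ℝ → ℂ := fun ρ ↦ eichlerIntegral f (UpperHalfPlane.ofComplex (Z ρ)) with hΦ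
  set g : ℝ → ℂ := fun ρ ↦ f (UpperHalfPlane.ofComplex (Z ρ)) *
      ((ξ₁ - ξ₂ : ℂ) * Complex.exp ((ρ : ℂ) + θ * I) / (Complex.exp ((ρ : ℂ) + θ * I) - 1) ^ 2) with hg
  have hgc : Continuous g := continuous_inner_integrand f hξ hθ
  have hderiv : ∀ ρ, HasDerivAt Φ (2 * π * I * g ρ) ρ := fun ρ ↦ by
    have h := hasDerivAt_eichler_zInv_line f hξ hθ ρ
    simp only [hΦ, hg, hZ, ← mul_assoc] at h ⊢
    exact h
  have hFTC := intervalIntegral.integral_eq_sub_of_hasDerivAt (a := 0) (b := |ℓ|) (fun ρ _ ↦ hderiv ρ)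
    ((continuous_const.mul hgc).intervalIntegrable _ _)
  have h2πI : (2 * π * I : ℂ) ≠ 0 := by
    apply mul_ne_zero (mul_ne_zero two_ne_zero _) Complex.I_ne_zero
    exact_mod_cast Real.pi_ne_zero
  have hint : ∫ ρ in (0 : ℝ)..|ℓ|, g ρ = (Φ |ℓ| - Φ 0) / (2 * π * I) := by
    rw [eq_div_iff h2πI, mul_comm, ← intervalIntegral.integral_const_mul, hFTC]
  show ∫ ρ in (0 : ℝ)..|ℓ|, g ρ = _
  rw [hint]
  -- the period
  have him : ∀ ρ : ℝ, 0 < (Z ρ).im := fun ρ ↦ im_zInv_pos hξ (line_im hθ ρ).1 (line_im hθ ρ).2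
  have hshift : ∀ ρ : ℝ, Z (ρ + ℓ) = moebius δ (Z ρ) := fun ρ ↦ by
    have h := zInv_add_log (δ := δ) hξ hκ hw (line_im hθ ρ).1 (line_im hθ ρ).2
    rw [← hℓ] at h
    have e : ((ρ + ℓ : ℝ) : ℂ) + θ * I = (ρ : ℂ) + θ * I + ℓ := by push_cast; ring
    simp only [hZ, e]
    exact h
  have hperiod : ∀ ρ : ℝ, Φ (ρ + ℓ) - Φ ρ = cuspSymbol f ⟨δ, hδ⟩ := fun ρ ↦ by
    simp only [hΦ]
    rw [hshift ρ, ← smul_ofComplex δ (him ρ)]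
    exact eichlerIntegral_smul_sub_holds f ⟨δ, hδ⟩ _
  rcases lt_or_gt_of_ne hℓ0 with hneg | hpos
  · rw [abs_of_neg hneg, if_neg (not_lt.mpr hneg.le)]
    have h := hperiod (-ℓ)
    rw [neg_add_cancel] at h
    rw [show Φ (-ℓ) - Φ 0 = -(Φ 0 - Φ (-ℓ)) by ring, h]
    ring
  · rw [abs_of_pos hpos, if_pos hpos]
    have h := hperiod 0
    rw [zero_add] at h
    rw [h]
    ring

end Inner

/-! ### Change of variables `z = z(ζ)` from the upper half-plane to the strip -/

section Change

variable {ξ₁ ξ₂ : ℝ}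

/-- The strip `0 < im ζ < π` is measurable. [folklore] -/
theorem measurableSet_strip : MeasurableSet {ζ : ℂ | 0 < ζ.im ∧ ζ.im < π} :=
  (measurableSet_lt measurable_const Complex.measurable_im).inter
    (measurableSet_lt Complex.measurable_im measurable_const)

/-- **`z` maps the strip onto the upper half-plane.** [folklore] -/
theorem image_zInv_strip (hξ : ξ₂ < ξ₁) :
    (fun ζ : ℂ ↦ (ξ₂ * Complex.exp ζ - ξ₁) / (Complex.exp ζ - 1)) '' {ζ : ℂ | 0 < ζ.im ∧ ζ.im < π} =
      {z : ℂ | 0 < z.im} := by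
  ext z
  constructor
  · rintro ⟨ζ, ⟨h0, hπ⟩, rfl⟩
    exact im_zInv_pos hξ h0 hπ
  · intro hz
    refine ⟨Complex.log ((z - ξ₁) / (z - ξ₂)), ?_, zInv_log_w hξ hz⟩
    have h := arg_w_mem_Ioo hξ hz
    simp only [mem_setOf_eq, Complex.log_im]
    exact h

/-- **`z` is injective on the strip** (left inverse `log ∘ w`). [folklore] -/
theorem injOn_zInv_strip (hξ : ξ₂ < ξ₁) :
    InjOn (fun ζ : ℂ ↦ (ξ₂ * Complex.exp ζ - ξ₁) / (Complex.exp ζ - 1)) {ζ : ℂ | 0 < ζ.im ∧ ζ.im < π} := by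
  intro ζ hζ ζ' hζ' h
  have e := congrArg (fun z : ℂ ↦ Complex.log ((z - ξ₁) / (z - ξ₂))) h
  simp only at e
  rwa [log_w_zInv hξ hζ.1 hζ.2, log_w_zInv hξ hζ'.1 hζ'.2] at e

/-- **Change of variables to the strip**: for any `F : ℂ → ℂ`,
`∫_{im z > 0} F(z) dz = ∫_{0 < im ζ < π} |z'(ζ)|² F(z(ζ)) dζ` (Mathlib's change of variables for
an injective differentiable map, Jacobian `|z'|²`). [folklore] -/
theorem setIntegral_uhp_eq_setIntegral_strip (hξ : ξ₂ < ξ₁) (F : ℂ → ℂ) :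
    ∫ z in {z : ℂ | 0 < z.im}, F z =
      ∫ ζ in {ζ : ℂ | 0 < ζ.im ∧ ζ.im < π},
        (‖(ξ₁ - ξ₂ : ℂ) * Complex.exp ζ / (Complex.exp ζ - 1) ^ 2‖ ^ 2 : ℝ) •
          F ((ξ₂ * Complex.exp ζ - ξ₁) / (Complex.exp ζ - 1)) := by
  rw [← image_zInv_strip hξ]
  rw [integral_image_eq_integral_abs_det_fderiv_smul volume measurableSet_strip
    (f' := fun ζ ↦ (ContinuousLinearMap.toSpanSingleton ℂ
      ((ξ₁ - ξ₂ : ℂ) * Complex.exp ζ / (Complex.exp ζ - 1) ^ 2)).restrictScalars ℝ)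
    (fun ζ hζ ↦ ((hasDerivAt_zInv hζ.1 hζ.2).hasFDerivAt.restrictScalars ℝ).hasFDerivWithinAt)
    (injOn_zInv_strip hξ)]
  refine setIntegral_congr_fun measurableSet_strip fun ζ _ ↦ ?_
  -- the real Jacobian of multiplication by `d` is `|d|²` (the tree's
  -- `det_restrictScalars_toSpanSingleton` of `ModularDegreeFormulaProofs`, inlined to keep the
  -- import closure small)
  have hdet : ∀ d : ℂ, ((ContinuousLinearMap.toSpanSingleton ℂ d).restrictScalars ℝ).det = ‖d‖ ^ 2 := by
    intro d
    have h1 : (((ContinuousLinearMap.toSpanSingleton ℂ d).restrictScalars ℝ : ℂ →L[ℝ] ℂ) :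
        ℂ →ₗ[ℝ] ℂ) = Algebra.lmul ℝ ℂ d := by
      ext x; simp [mul_comm]
    rw [ContinuousLinearMap.det, h1, ← Algebra.norm_apply, Algebra.norm_complex_apply,
      Complex.normSq_eq_norm_sq]
  rw [hdet, abs_of_nonneg (sq_nonneg _)]

/-- **The integrand on the strip.** For `ζ` in the strip, with `z = z(ζ)`:
`log |w(z)| = re ζ`, `arg w(z) = im ζ`, and `|z'(ζ)|² · \overline{ζ'(z)} = z'(ζ)`; hence
`|z'|² · [G(z) 𝟙(log|w z|) (i b'(arg w z) \overline{ζ'(z)})] = i b'(im ζ) 𝟙(re ζ) G(z(ζ)) z'(ζ)`. [folklore] -/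
theorem strip_integrand_eq (hξ : ξ₂ < ξ₁) (G : ℂ → ℂ) (χ : ℝ → ℂ) (β : ℝ → ℂ) {ζ : ℂ}
    (h0 : 0 < ζ.im) (hπ : ζ.im < π) :
    (‖(ξ₁ - ξ₂ : ℂ) * Complex.exp ζ / (Complex.exp ζ - 1) ^ 2‖ ^ 2 : ℝ) •
        (G ((ξ₂ * Complex.exp ζ - ξ₁) / (Complex.exp ζ - 1)) *
          χ (Real.log ‖((ξ₂ * Complex.exp ζ - ξ₁) / (Complex.exp ζ - 1) - ξ₁) /
              ((ξ₂ * Complex.exp ζ - ξ₁) / (Complex.exp ζ - 1) - ξ₂)‖) *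
          (β (Complex.arg (((ξ₂ * Complex.exp ζ - ξ₁) / (Complex.exp ζ - 1) - ξ₁) /
              ((ξ₂ * Complex.exp ζ - ξ₁) / (Complex.exp ζ - 1) - ξ₂))) *
            conj (1 / ((ξ₂ * Complex.exp ζ - ξ₁) / (Complex.exp ζ - 1) - ξ₁) -
              1 / ((ξ₂ * Complex.exp ζ - ξ₁) / (Complex.exp ζ - 1) - ξ₂)))) =
      β ζ.im * χ ζ.re * (G ((ξ₂ * Complex.exp ζ - ξ₁) / (Complex.exp ζ - 1)) *
        ((ξ₁ - ξ₂ : ℂ) * Complex.exp ζ / (Complex.exp ζ - 1) ^ 2)) := by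
  have hlog := log_w_zInv hξ h0 hπ
  have hre : Real.log ‖((ξ₂ * Complex.exp ζ - ξ₁) / (Complex.exp ζ - 1) - ξ₁) /
      ((ξ₂ * Complex.exp ζ - ξ₁) / (Complex.exp ζ - 1) - ξ₂)‖ = ζ.re := by
    have := congrArg Complex.re hlog
    rwa [Complex.log_re] at this
  have him : Complex.arg (((ξ₂ * Complex.exp ζ - ξ₁) / (Complex.exp ζ - 1) - ξ₁) /
      ((ξ₂ * Complex.exp ζ - ξ₁) / (Complex.exp ζ - 1) - ξ₂)) = ζ.im := by
    have := congrArg Complex.im hlog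
    rwa [Complex.log_im] at this
  rw [hre, him]
  set d : ℂ := (ξ₁ - ξ₂ : ℂ) * Complex.exp ζ / (Complex.exp ζ - 1) ^ 2 with hd
  have hd0 : d ≠ 0 := zInv_deriv_ne_zero hξ h0 hπ
  have hprod := logDeriv_w_zInv_mul hξ h0 hπ
  rw [← hd] at hprod
  -- `ζ'(z(ζ)) = d⁻¹`
  have hinv : (1 / ((ξ₂ * Complex.exp ζ - ξ₁) / (Complex.exp ζ - 1) - ξ₁) -
      1 / ((ξ₂ * Complex.exp ζ - ξ₁) / (Complex.exp ζ - 1) - ξ₂)) = d⁻¹ :=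
    eq_inv_of_mul_eq_one_left hprod
  rw [hinv, map_inv₀, Complex.real_smul]
  have hn : ((‖d‖ ^ 2 : ℝ) : ℂ) = d * conj d := by
    rw [Complex.mul_conj, Complex.normSq_eq_norm_sq, Complex.ofReal_pow]
  rw [hn]
  have hcd : conj d ≠ 0 := (map_ne_zero _).mpr hd0
  field_simp

end Change

/-! ### Fubini on the strip -/

section Fubini

/-- **Fubini on the strip**: `∫_{0 < im ζ < π} H(ζ) dζ = ∫_{θ ∈ (0,π)} ∫_ℝ H(ρ + iθ) dρ dθ` for `H`
integrable on the strip (`ℂ ≅ ℝ²` is measure preserving, `Complex.volume_preserving_equiv_real_prod`). [folklore] -/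
theorem setIntegral_strip_eq_iterated (H : ℂ → ℂ) (hH : IntegrableOn H {ζ : ℂ | 0 < ζ.im ∧ ζ.im < π}) :
    ∫ ζ in {ζ : ℂ | 0 < ζ.im ∧ ζ.im < π}, H ζ = ∫ θ in Ioo (0 : ℝ) π, ∫ ρ : ℝ, H ((ρ : ℂ) + θ * I) := by
  set e := Complex.measurableEquivRealProd.symm with he
  have hmp : MeasurePreserving e volume volume := Complex.volume_preserving_equiv_real_prod.symm
  have hpre : e ⁻¹' {ζ : ℂ | 0 < ζ.im ∧ ζ.im < π} = (univ : Set ℝ) ×ˢ Ioo (0 : ℝ) π := by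
    ext p
    simp [he, Complex.measurableEquivRealProd, Complex.equivRealProdCLM_symm_apply, mem_Ioo]
  have h1 := hmp.setIntegral_preimage_emb e.measurableEmbedding H {ζ : ℂ | 0 < ζ.im ∧ ζ.im < π}
  rw [← h1, hpre]
  have hint : IntegrableOn (fun p ↦ H (e p)) ((univ : Set ℝ) ×ˢ Ioo (0 : ℝ) π) := by
    have := (hmp.integrableOn_comp_preimage e.measurableEmbedding).mpr hH
    rwa [hpre] at this
  rw [IntegrableOn, Measure.volume_eq_prod, ← Measure.prod_restrict, Measure.restrict_univ] at hint
  rw [Measure.volume_eq_prod, ← Measure.prod_restrict, Measure.restrict_univ, integral_prod_symm _ hint]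
  refine setIntegral_congr_fun measurableSet_Ioo fun θ _ ↦ integral_congr_ae (Eventually.of_forall fun ρ ↦ ?_)
  simp [he, Complex.measurableEquivRealProd, Complex.equivRealProdCLM_symm_apply]

end Fubini

/-! ### The pairing integral over the upper half-plane -/

section Main

variable {N : ℕ} [NeZero N] {ξ₁ ξ₂ κ ε : ℝ} {δ : SL(2, ℤ)}

/-- **The band integral.** For `f ∈ S₂(Γ₀(N))`, a hyperbolic `δ ∈ Γ₀(N)` with adapted coordinate
`w(z) = (z - ξ₁)/(z - ξ₂)` (`w(δz) = κ w(z)`, `ξ₂ < ξ₁`, `κ > 0`, `κ ≠ 1`), the band function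
`b(θ) = smoothTransition((θ - (π/2 - ε))/(2ε))`, `0 < ε < π/2`, and `ℓ = log κ`:
`∫_{im z > 0} f(z) · 𝟙_{[0,|ℓ|)}(log |w(z)|) · (i b'(arg w(z)) \overline{ζ'(z)}) dx dy = sign(ℓ) {∞, δ∞}_f / (2π)`,
where `ζ' = 1/(z - ξ₁) - 1/(z - ξ₂) = w'/w` and `i b'(arg w) \overline{ζ'} = 2 ∂B₀/∂z̄` for
`B₀ = b ∘ arg ∘ w`. Proof: the change of variables `z = z(ζ)` to the strip turns the integrand into
`i b'(im ζ) 𝟙_{[0,|ℓ|)}(re ζ) f(z(ζ)) z'(ζ)` (`strip_integrand_eq`); by Fubini the `ρ`-integral is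
`sign(ℓ){∞, δ∞}_f/(2πi)` for every `θ` (`inner_integral_eq`), and `∫₀^π b' = 1`
(`integral_deriv_band`). This is the evaluation of the pairing of the cusp form `f dz` with the
closed dual form of the closed geodesic of `δ` (Farkas–Kra II.3.3, III.1.1 (1.1.1)), unfolded to
the cyclic cover `⟨δ⟩∖ℍ ≅` strip. [cite: FarkasKra1992, II.3.3 and III.1.1 (1.1.1)] -/
theorem setIntegral_uhp_band_eq (f : CuspForm (Gamma0 N) 2) (hδ : δ ∈ Gamma0 N) (hξ : ξ₂ < ξ₁)
    (hκ : 0 < κ) (hκ1 : κ ≠ 1)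
    (hw : ∀ z : ℂ, 0 < z.im → (moebius δ z - ξ₁) / (moebius δ z - ξ₂) = κ * ((z - ξ₁) / (z - ξ₂)))
    (hε : 0 < ε) (hε' : ε < π / 2) :
    ∫ z in {z : ℂ | 0 < z.im},
        f (UpperHalfPlane.ofComplex z) *
          (Ico (0 : ℝ) |Real.log κ|).indicator (fun _ ↦ (1 : ℂ)) (Real.log ‖(z - ξ₁) / (z - ξ₂)‖) *
          (I * ((deriv (fun θ : ℝ ↦ Real.smoothTransition ((θ - (π / 2 - ε)) / (2 * ε)))
              (Complex.arg ((z - ξ₁) / (z - ξ₂))) : ℝ) : ℂ) * conj (1 / (z - ξ₁) - 1 / (z - ξ₂))) =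
      (if 0 < Real.log κ then (1 : ℂ) else -1) * cuspSymbol f ⟨δ, hδ⟩ / (2 * π) := by
  set ℓ : ℝ := Real.log κ with hℓ
  set b : ℝ → ℝ := fun θ : ℝ ↦ Real.smoothTransition ((θ - (π / 2 - ε)) / (2 * ε)) with hb
  set zI : ℂ → ℂ := fun ζ ↦ (ξ₂ * Complex.exp ζ - ξ₁) / (Complex.exp ζ - 1) with hzI
  set zI' : ℂ → ℂ := fun ζ ↦ (ξ₁ - ξ₂ : ℂ) * Complex.exp ζ / (Complex.exp ζ - 1) ^ 2 with hzI'
  set g : ℂ → ℂ := fun ζ ↦ f (UpperHalfPlane.ofComplex (zI ζ)) * zI' ζ with hg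
  set H : ℂ → ℂ := fun ζ ↦ (I * ((deriv b ζ.im : ℝ) : ℂ)) *
      (Ico (0 : ℝ) |ℓ|).indicator (fun _ ↦ (1 : ℂ)) ζ.re * g ζ with hH
  set S : Set ℂ := {ζ : ℂ | 0 < ζ.im ∧ ζ.im < π} with hS
  -- (1) change of variables to the strip
  have step1 : ∫ z in {z : ℂ | 0 < z.im},
      f (UpperHalfPlane.ofComplex z) *
        (Ico (0 : ℝ) |ℓ|).indicator (fun _ ↦ (1 : ℂ)) (Real.log ‖(z - ξ₁) / (z - ξ₂)‖) *
        (I * ((deriv b (Complex.arg ((z - ξ₁) / (z - ξ₂))) : ℝ) : ℂ) * conj (1 / (z - ξ₁) - 1 / (z - ξ₂))) =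
      ∫ ζ in S, H ζ := by
    rw [setIntegral_uhp_eq_setIntegral_strip hξ]
    refine setIntegral_congr_fun measurableSet_strip fun ζ hζ ↦ ?_
    have h := strip_integrand_eq hξ (fun z ↦ f (UpperHalfPlane.ofComplex z))
      (fun t ↦ (Ico (0 : ℝ) |ℓ|).indicator (fun _ ↦ (1 : ℂ)) t) (fun θ ↦ I * ((deriv b θ : ℝ) : ℂ)) hζ.1 hζ.2
    rw [h]
  -- (2) integrability of `H` on the strip: bounded with compact support `K ⊆ S`
  set K : Set ℂ := (Icc (0 : ℝ) |ℓ|) ×ℂ (Icc (π / 2 - ε) (π / 2 + ε)) with hK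
  have hKc : IsCompact K := isCompact_Icc.reProdIm isCompact_Icc
  have hKS : K ⊆ S := fun ζ hζ ↦ ⟨by linarith [hζ.2.1], by linarith [hζ.2.2]⟩
  have hgc : ContinuousOn g S := by
    have hden : ∀ ζ ∈ S, Complex.exp ζ - 1 ≠ 0 := fun ζ hζ ↦ exp_sub_one_ne_zero hζ.1 hζ.2
    have hzIc : ContinuousOn zI S :=
      ((continuousOn_const.mul Complex.continuous_exp.continuousOn).sub continuousOn_const).div
        (Complex.continuous_exp.continuousOn.sub continuousOn_const) hden
    have hzI'c : ContinuousOn zI' S :=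
      (continuousOn_const.mul Complex.continuous_exp.continuousOn).div
        ((Complex.continuous_exp.continuousOn.sub continuousOn_const).pow 2)
        fun ζ hζ ↦ pow_ne_zero 2 (hden ζ hζ)
    have hfc : ContinuousOn (fun z : ℂ ↦ f (UpperHalfPlane.ofComplex z)) {z : ℂ | 0 < z.im} :=
      (isCuspFunction_one f).continuousOn_comp_ofComplex
    exact (hfc.comp hzIc fun ζ hζ ↦ im_zInv_pos hξ hζ.1 hζ.2).mul hzI'c
  obtain ⟨Mg, hMg⟩ := hKc.exists_bound_of_continuousOn (hgc.mono hKS)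
  obtain ⟨Bb, hBb⟩ := exists_bound_deriv_band (ε := ε) hε
  have hBb0 : 0 ≤ Bb := (abs_nonneg _).trans (hBb 0)
  have hMg0 : 0 ≤ Mg := by
    have h0K : ((0 : ℝ) : ℂ) + (π / 2 : ℝ) * I ∈ K := by
      refine ⟨?_, ?_⟩ <;> simp [abs_nonneg, hε.le]
    exact (norm_nonneg _).trans (hMg _ h0K)
  -- support and bound
  have hHzero : ∀ ζ ∈ S \ K, H ζ = 0 := by
    rintro ζ ⟨-, hζK⟩
    simp only [hK, Complex.mem_reProdIm, not_and_or] at hζK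
    simp only [hH]
    rcases hζK with h | h
    · have : ζ.re ∉ Ico (0 : ℝ) |ℓ| := fun h' ↦ h (Ico_subset_Icc_self h')
      rw [indicator_of_notMem this, mul_zero, zero_mul]
    · rw [deriv_band_eq_zero hε h]; simp
  have hHbound : ∀ ζ ∈ K, ‖H ζ‖ ≤ Bb * Mg := by
    intro ζ hζ
    simp only [hH]
    rw [norm_mul, norm_mul, norm_mul, Complex.norm_I, one_mul, Complex.norm_real, Real.norm_eq_abs]
    have h1 : ‖(Ico (0 : ℝ) |ℓ|).indicator (fun _ ↦ (1 : ℂ)) ζ.re‖ ≤ 1 := by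
      by_cases h : ζ.re ∈ Ico (0 : ℝ) |ℓ|
      · rw [indicator_of_mem h, norm_one]
      · rw [indicator_of_notMem h, norm_zero]; exact zero_le_one
    have hA : |deriv b ζ.im| * ‖(Ico (0 : ℝ) |ℓ|).indicator (fun _ ↦ (1 : ℂ)) ζ.re‖ ≤ Bb * 1 :=
      mul_le_mul (hBb _) h1 (norm_nonneg _) hBb0
    calc |deriv b ζ.im| * ‖(Ico (0 : ℝ) |ℓ|).indicator (fun _ ↦ (1 : ℂ)) ζ.re‖ * ‖g ζ‖
        ≤ Bb * 1 * Mg := mul_le_mul hA (hMg ζ hζ) (norm_nonneg _) (by positivity)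
      _ = Bb * Mg := by ring
  -- measurability on `S`
  have hHm : AEStronglyMeasurable H (volume.restrict S) := by
    have h1 : AEStronglyMeasurable (fun ζ : ℂ ↦ I * ((deriv b ζ.im : ℝ) : ℂ)) (volume.restrict S) := by
      have hc : Continuous fun ζ : ℂ ↦ I * ((deriv b ζ.im : ℝ) : ℂ) :=
        continuous_const.mul (Complex.continuous_ofReal.comp
          (((contDiff_band (ε := ε)).continuous_deriv le_rfl).comp Complex.continuous_im))
      exact hc.aestronglyMeasurable
    have h2 : AEStronglyMeasurable (fun ζ : ℂ ↦ (Ico (0 : ℝ) |ℓ|).indicator (fun _ ↦ (1 : ℂ)) ζ.re)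
        (volume.restrict S) :=
      ((measurable_const.indicator measurableSet_Ico).comp Complex.measurable_re).aestronglyMeasurable
    exact (h1.mul h2).mul (hgc.aestronglyMeasurable measurableSet_strip)
  have hHint : IntegrableOn H S := by
    have hK_int : IntegrableOn H K := by
      haveI : IsFiniteMeasure (volume.restrict K) := isFiniteMeasure_restrict.mpr hKc.measure_lt_top.ne
      refine Integrable.mono' (g := fun _ ↦ Bb * Mg) (integrable_const _)
        (hHm.mono_measure (Measure.restrict_mono hKS le_rfl)) ?_
      exact (ae_restrict_iff' hKc.measurableSet).mpr (ae_of_all _ hHbound)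
    exact hK_int.of_forall_sdiff_eq_zero measurableSet_strip hHzero
  -- (3) Fubini and the inner integral
  rw [step1, setIntegral_strip_eq_iterated H hHint]
  have hinner : ∀ θ ∈ Ioo (0 : ℝ) π, ∫ ρ : ℝ, H ((ρ : ℂ) + θ * I) =
      I * ((deriv b θ : ℝ) : ℂ) *
        ((if 0 < ℓ then (1 : ℂ) else -1) * cuspSymbol f ⟨δ, hδ⟩ / (2 * π * I)) := by
    intro θ hθ
    have hre : ∀ ρ : ℝ, ((ρ : ℂ) + θ * I).re = ρ := fun ρ ↦ by simp
    have him : ∀ ρ : ℝ, ((ρ : ℂ) + θ * I).im = θ := fun ρ ↦ by simp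
    have e1 : (fun ρ : ℝ ↦ H ((ρ : ℂ) + θ * I)) =
        fun ρ ↦ I * ((deriv b θ : ℝ) : ℂ) * (Ico (0 : ℝ) |ℓ|).indicator (fun ρ ↦ g ((ρ : ℂ) + θ * I)) ρ := by
      funext ρ
      simp only [hH, hre, him]
      by_cases h : ρ ∈ Ico (0 : ℝ) |ℓ|
      · rw [indicator_of_mem h, indicator_of_mem h, mul_one]
      · simp [indicator_of_notMem h]
    rw [e1, integral_const_mul, integral_indicator measurableSet_Ico, integral_Ico_eq_integral_Ioc,
      ← intervalIntegral.integral_of_le (abs_nonneg ℓ)]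
    congr 1
    exact inner_integral_eq f hδ hξ hκ hκ1 hw hθ
  rw [setIntegral_congr_fun measurableSet_Ioo hinner]
  -- (4) the outer integral `∫₀^π b' = 1`
  have hout : ∫ θ in Ioo (0 : ℝ) π, I * ((deriv b θ : ℝ) : ℂ) *
      ((if 0 < ℓ then (1 : ℂ) else -1) * cuspSymbol f ⟨δ, hδ⟩ / (2 * π * I)) =
      I * ((if 0 < ℓ then (1 : ℂ) else -1) * cuspSymbol f ⟨δ, hδ⟩ / (2 * π * I)) := by
    have e2 : (fun θ : ℝ ↦ I * ((deriv b θ : ℝ) : ℂ) *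
        ((if 0 < ℓ then (1 : ℂ) else -1) * cuspSymbol f ⟨δ, hδ⟩ / (2 * π * I))) =
        fun θ ↦ (I * ((if 0 < ℓ then (1 : ℂ) else -1) * cuspSymbol f ⟨δ, hδ⟩ / (2 * π * I))) *
          ((deriv b θ : ℝ) : ℂ) := by
      funext θ; ring
    have hI1 : ∫ x in Ioo (0 : ℝ) π, deriv b x = 1 := by
      rw [← integral_Ioc_eq_integral_Ioo, ← intervalIntegral.integral_of_le Real.pi_pos.le]
      exact integral_deriv_band hε hε'
    rw [e2, integral_const_mul, integral_complex_ofReal, hI1]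
    simp
  have hπ0 : (π : ℂ) ≠ 0 := by exact_mod_cast Real.pi_ne_zero
  rw [hout, ← mul_div_assoc, div_eq_div_iff (mul_ne_zero (mul_ne_zero two_ne_zero hπ0) Complex.I_ne_zero)
    (mul_ne_zero two_ne_zero hπ0)]
  ring

end Main

end HypStrip

end Literature.NumberTheory.EllipticCurves.ModularForms

end
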